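import Summits.Ventures.CertifiedManyBodySolver.Downfold.TppSeamOrderFilling
import Summits.Ventures.CertifiedManyBodySolver.Downfold.BoxesLa214V19
import Literature.MathematicalPhysics.QuantumLattice.DWaveOrderParameterCellsFilling
import HarnessLib

/-!
# The ORDER word of object M on a typed box from FOUR CORNER certificates of a `(t', U)` rectangle
# containing the box's cell (n-form, nested bulge): the rectangle edition of `TppSeamOrderFilling`

Venture CertifiedManyBodySolver, cell `pub/hubbard-downfold` (stage S1 ↔ S2 seam), seat hubbard-downfold-mod-1;
namespace `Summit.Ventures.CertifiedManyBodySolver.Downfold`. Sequel of `TppSeamOrderFilling.lean` (p486156: ONE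
sourced floor + the CELL-WIDE canonical window ⇒ a pair-amplitude ceiling on the box, paying `4·eS.dev t'₀` for the
`t'` transport and `max 0 (U₀ − eU.lo)` for `U`). hubbard-downfold-unc-1's n-form rectangle theorems
(`Literature/…/DWaveOrderParameterCellsFilling.lean` §3, p491442:
`meanEnergy_pairSource_le_nestedBulge_of_rect_filling` / `meanEnergy_pairSource_lt_on_rect_filling`) replace both
transport costs by the uniform NESTED BULGE of a `(t', U)` rectangle `[s₁, s₂] × [U₁, U₂]` read off its FOUR CORNERS
(per corner: a canonical cap `e(1, sⱼ, Uᵢ, n) ≤ Rⱼᵢ`, a sourced floor `loⱼᵢ ≤ E(sⱼ, Uᵢ, μ₀, h)`, one `K₂`-row end and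
one docc-row end by position) — second order in both widths, no cell-wide `R`, no `eS.dev`/`eU.dev` term. This file
is the SEAM: it reads those rectangle statements ON A TYPED ONE-BAND BOX whose `(tp/t, U/t)` cell sits inside the
rectangle and whose filling entry sits inside a strip `[n₁, n₂] ⊂ (0, 2)` on which the corner data are supplied.

* `nestedBulge_gap_mono` — the bulge numerator is antitone in the Legendre term: replacing `μ₀·n` by
  `c ≤ μ₀·n` (here `c = min (μ₀·n₁) (μ₀·n₂)`, `TppSeamOrderFilling.min_mul_le_mul_of_mem_Icc`) only enlarges it.
* `holdsOn_pairAmplitude_le_nestedBulge_of_cornerWords_filling` — THE RECTANGLE SEAM (near-minimisers): on `B`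
  (entries `eU, eS, eSS, eN`; rectangle `[s₁,s₂] × [U₁,U₂] ⊇ [eS.lo, eS.hi] × [eU.lo, eU.hi]`, strip
  `[n₁,n₂] ⊇ [eN.lo, eN.hi]`, `0 ≤ U₁`, `0 < n₁`, `n₂ < 2`; corner caps and corner slope words for EVERY `n` in the
  strip; corner floors at `μ₀`), every translation-invariant `σ` of density `p n` whose object-M mean energy at the
  member's `(1, p tp/t, p tpp/t, p U/t)` is within `ε` of the canonical minimum has
  `e_P(σ) ≤ (BULGE(min (μ₀n₁) (μ₀n₂)) + (32/π²)·m + ε)/h`, `m = max |eSS.lo| |eSS.hi|`;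
* `holdsOn_pairAmplitude_lt_of_cornerWords_filling_near` — THE ABSENT(`< m₀`) WORD ON THE BOX from the four corners:
  `BULGE(min (μ₀n₁) (μ₀n₂)) + (32/π²)·m < h·m₀` ⇒ no translation-invariant canonical minimiser of object M at any
  member's couplings and filling has `d`-wave pair amplitude `≥ m₀`;
* `boxLa214E_M15v19_pairAmplitude_lt_of_cornerWords` — THE TARGET SHAPE FOR S2 on the La-214 `x = 1/8` object-E box
  of record v1.9 (`BoxesLa214V19`, p492071): rectangle = the box's own cell corners `tp/t_eff ∈ {−0.30, −0.20}` ×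
  `U/t_eff ∈ {6.1, 14.7}`, strip `n ∈ [0.855, 0.895]`, `t'' = 0` (object E: no model-form residual) — sixteen corner
  inputs + one inequality give ABSENT(`< m₀`) on `boxLa214E_M15v19` (hubbard-downfold-unc-1's production rule
  2026-08-27T03:11:28Z: «anchors at the CORNERS of the material cells»).

Everything here is PROVED; no definition. HONEST FRAMING: ceiling/ABSENT-side bookkeeping at the variational level
(translation-invariant canonical near-minimisers; the torus-limit order parameter of object M is not defined in the
tree); nothing here floors order or bears on `T_c`; every output is conditional on the sixteen corner certificates
fed in — NO sourced producer exists today, so no number about any material follows from this file; the box values are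
S1's screening-grade output typed verbatim.
-/

noncomputable section

namespace Summit.Ventures.CertifiedManyBodySolver.Downfold

open NonemptyInterval Literature.MathematicalPhysics.QuantumLattice
  Literature.MathematicalPhysics.QuantumLattice.ThermodynamicLimit Literature.Probability.LatticeModels
  _root_.Filter

/-! ### §1 The rectangle seam on a typed box -/

/-- **The nested-bulge numerator is antitone in the Legendre term**: for `c ≤ d` the column gaps
`max (R − d − lo) (R' − d − lo')` are at most the gaps with `c`, hence so is the `max` of the two columns with the
same bulge add-ons `X₁, X₂`. [folklore] -/
theorem nestedBulge_gap_mono {c d R₁₁ R₁₂ R₂₁ R₂₂ lo₁₁ lo₁₂ lo₂₁ lo₂₂ X₁ X₂ : ℝ} (hcd : c ≤ d) :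
    max (max (R₁₁ - d - lo₁₁) (R₁₂ - d - lo₁₂) + X₁) (max (R₂₁ - d - lo₂₁) (R₂₂ - d - lo₂₂) + X₂) ≤
      max (max (R₁₁ - c - lo₁₁) (R₁₂ - c - lo₁₂) + X₁) (max (R₂₁ - c - lo₂₁) (R₂₂ - c - lo₂₂) + X₂) := by
  have h₁ : R₁₁ - d - lo₁₁ ≤ R₁₁ - c - lo₁₁ := by linarith
  have h₂ : R₁₂ - d - lo₁₂ ≤ R₁₂ - c - lo₁₂ := by linarith
  have h₃ : R₂₁ - d - lo₂₁ ≤ R₂₁ - c - lo₂₁ := by linarith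
  have h₄ : R₂₂ - d - lo₂₂ ≤ R₂₂ - c - lo₂₂ := by linarith
  exact max_le_max (add_le_add (max_le_max h₁ h₂) le_rfl) (add_le_add (max_le_max h₃ h₄) le_rfl)

/-- **THE RECTANGLE ORDER-WORD SEAM (n-form, near-minimisers).** Let `B` carry entries `eU, eS, eSS, eN` for `U/t`,
`tp/t`, `tpp/t`, `n`; let `[s₁, s₂] × [U₁, U₂]` be a rectangle containing the box's `(tp/t, U/t)` cell and `[n₁, n₂]`
a filling strip containing `[eN.lo, eN.hi]` with `0 ≤ U₁`, `0 < n₁`, `n₂ < 2`; at the four corners `(sⱼ, Uᵢ)` let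
canonical caps `e(1,sⱼ,Uᵢ,n) ≤ Rⱼᵢ` and the one-sided `K₂`/docc torus-limit words hold for EVERY `n ∈ [n₁, n₂]`, and
sourced floors `loⱼᵢ ≤ E(sⱼ,Uᵢ,μ₀,h)` hold at the producer's `μ₀` (`h > 0`). Then on `B`: every translation-invariant
`σ` with `σ.density = p n` whose source-free object-M mean energy at `(1, p tp/t, p tpp/t, p U/t)` is within `ε` of
the canonical minimum has `e_P(σ) ≤ (BULGE(min (μ₀·n₁) (μ₀·n₂)) + (32/π²)·m + ε)/h`, `m = max |eSS.lo| |eSS.hi|`, where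
BULGE is hubbard-downfold-unc-1's uniform nested bulge of the rectangle (`DWaveOrderParameterCellsFilling` §3) with
the Legendre term taken at the worse end of the strip. [cite: KomaTasaki1994, §1] -/
theorem holdsOn_pairAmplitude_le_nestedBulge_of_cornerWords_filling {B : OneBandBox} {eU eS eSS eN : Entry}
    (hU : B .UOverT = some eU) (hS : B .tpOverT = some eS) (hSS : B .tppOverT = some eSS)
    (hN : B .filling = some eN) {s₁ s₂ U₁ U₂ n₁ n₂ : ℝ}
    (hS₁ : s₁ ≤ ((eS.encl.fst : ℚ) : ℝ)) (hS₂ : ((eS.encl.snd : ℚ) : ℝ) ≤ s₂)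
    (hU₁ : U₁ ≤ ((eU.encl.fst : ℚ) : ℝ)) (hU₂ : ((eU.encl.snd : ℚ) : ℝ) ≤ U₂)
    (hn₁ : n₁ ≤ ((eN.encl.fst : ℚ) : ℝ)) (hn₂ : ((eN.encl.snd : ℚ) : ℝ) ≤ n₂)
    (hU₁0 : 0 ≤ U₁) (hs : s₁ < s₂) (hUlt : U₁ < U₂) (hn₁0 : 0 < n₁) (hn₂2 : n₂ < 2)
    {h : ℝ} (hh : 0 < h) (μ₀ : ℝ)
    {R₁₁ R₂₁ R₁₂ R₂₂ lo₁₁ lo₂₁ lo₁₂ lo₂₂ K₁₁ K₁₂ J₂₁ J₂₂ A₁₁ A₂₁ B₁₂ B₂₂ : ℝ}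
    (hR₁₁ : ∀ n ∈ Set.Icc n₁ n₂, energyDensityTT' 1 s₁ U₁ n ≤ R₁₁)
    (hR₂₁ : ∀ n ∈ Set.Icc n₁ n₂, energyDensityTT' 1 s₂ U₁ n ≤ R₂₁)
    (hR₁₂ : ∀ n ∈ Set.Icc n₁ n₂, energyDensityTT' 1 s₁ U₂ n ≤ R₁₂)
    (hR₂₂ : ∀ n ∈ Set.Icc n₁ n₂, energyDensityTT' 1 s₂ U₂ n ≤ R₂₂)
    (h₁₁ : ∀ n ∈ Set.Icc n₁ n₂, ∀ (ω : InfVolFermionState 2) (Ls : ℕ → ℕ)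
      (ψ : ∀ L, Fock (Orb (FermionTorus 2 L))),
      Tendsto Ls atTop atTop →
      (∀ j, IsGroundStateInSector (hubbardTorusTT' (Ls j) 1 s₁ U₁) (rectN n (Ls j)) 0 (ψ (Ls j))) →
      (∀ j, star (ψ (Ls j)) ⬝ᵥ ψ (Ls j) = 1) → ω.IsTorusLimitOf ψ Ls →
      ω.meanEnergy (hubbardTTPrimeFermionInteraction 0 1 0) 1 ≤ K₁₁ ∧
        (ω.expect ({0} : Finset (Site 2))
          (nAt 0 (Finset.mem_singleton_self 0) 0 * nAt 0 (Finset.mem_singleton_self 0) 1)).re ≤ A₁₁)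
    (h₁₂ : ∀ n ∈ Set.Icc n₁ n₂, ∀ (ω : InfVolFermionState 2) (Ls : ℕ → ℕ)
      (ψ : ∀ L, Fock (Orb (FermionTorus 2 L))),
      Tendsto Ls atTop atTop →
      (∀ j, IsGroundStateInSector (hubbardTorusTT' (Ls j) 1 s₁ U₂) (rectN n (Ls j)) 0 (ψ (Ls j))) →
      (∀ j, star (ψ (Ls j)) ⬝ᵥ ψ (Ls j) = 1) → ω.IsTorusLimitOf ψ Ls →
      ω.meanEnergy (hubbardTTPrimeFermionInteraction 0 1 0) 1 ≤ K₁₂ ∧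
        B₁₂ ≤ (ω.expect ({0} : Finset (Site 2))
          (nAt 0 (Finset.mem_singleton_self 0) 0 * nAt 0 (Finset.mem_singleton_self 0) 1)).re)
    (h₂₁ : ∀ n ∈ Set.Icc n₁ n₂, ∀ (ω : InfVolFermionState 2) (Ls : ℕ → ℕ)
      (ψ : ∀ L, Fock (Orb (FermionTorus 2 L))),
      Tendsto Ls atTop atTop →
      (∀ j, IsGroundStateInSector (hubbardTorusTT' (Ls j) 1 s₂ U₁) (rectN n (Ls j)) 0 (ψ (Ls j))) →
      (∀ j, star (ψ (Ls j)) ⬝ᵥ ψ (Ls j) = 1) → ω.IsTorusLimitOf ψ Ls →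
      J₂₁ ≤ ω.meanEnergy (hubbardTTPrimeFermionInteraction 0 1 0) 1 ∧
        (ω.expect ({0} : Finset (Site 2))
          (nAt 0 (Finset.mem_singleton_self 0) 0 * nAt 0 (Finset.mem_singleton_self 0) 1)).re ≤ A₂₁)
    (h₂₂ : ∀ n ∈ Set.Icc n₁ n₂, ∀ (ω : InfVolFermionState 2) (Ls : ℕ → ℕ)
      (ψ : ∀ L, Fock (Orb (FermionTorus 2 L))),
      Tendsto Ls atTop atTop →
      (∀ j, IsGroundStateInSector (hubbardTorusTT' (Ls j) 1 s₂ U₂) (rectN n (Ls j)) 0 (ψ (Ls j))) →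
      (∀ j, star (ψ (Ls j)) ⬝ᵥ ψ (Ls j) = 1) → ω.IsTorusLimitOf ψ Ls →
      J₂₂ ≤ ω.meanEnergy (hubbardTTPrimeFermionInteraction 0 1 0) 1 ∧
        B₂₂ ≤ (ω.expect ({0} : Finset (Site 2))
          (nAt 0 (Finset.mem_singleton_self 0) 0 * nAt 0 (Finset.mem_singleton_self 0) 1)).re)
    (hlo₁₁ : lo₁₁ ≤ dWaveSourceEnergyDensityTT' s₁ U₁ μ₀ h) (hlo₂₁ : lo₂₁ ≤ dWaveSourceEnergyDensityTT' s₂ U₁ μ₀ h)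
    (hlo₁₂ : lo₁₂ ≤ dWaveSourceEnergyDensityTT' s₁ U₂ μ₀ h) (hlo₂₂ : lo₂₂ ≤ dWaveSourceEnergyDensityTT' s₂ U₂ μ₀ h) :
    HoldsOn (fun p : OneBandCoord → ℝ => ∀ (ε : ℝ) (σ : InfVolFermionState 2), σ.IsTranslationInvariant →
      σ.density = p .filling →
      σ.meanEnergy (hubbardTT'T''FermionInteraction 1 (p .tpOverT) (p .tppOverT) (p .UOverT)) 2 ≤
        (hubbardTT'T''FermionInteraction 1 (p .tpOverT) (p .tppOverT) (p .UOverT)).tiGroundEnergyDensityAt 2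
          (p .filling) + ε →
      σ.meanEnergy (pairSourceInteraction dWaveFormFactor) 1 ≤
        (max (max (R₁₁ - min (μ₀ * n₁) (μ₀ * n₂) - lo₁₁) (R₁₂ - min (μ₀ * n₁) (μ₀ * n₂) - lo₁₂) +
              (U₂ - U₁) *
                (max (A₁₁ - min ((lo₁₂ - lo₁₁) / (U₂ - U₁)) ((lo₂₂ - lo₂₁) / (U₂ - U₁))) 0 *
                  max (max ((lo₁₂ - lo₁₁) / (U₂ - U₁)) ((lo₂₂ - lo₂₁) / (U₂ - U₁)) - B₁₂) 0) /
                (max (A₁₁ - min ((lo₁₂ - lo₁₁) / (U₂ - U₁)) ((lo₂₂ - lo₂₁) / (U₂ - U₁))) 0 +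
                  max (max ((lo₁₂ - lo₁₁) / (U₂ - U₁)) ((lo₂₂ - lo₂₁) / (U₂ - U₁)) - B₁₂) 0))
            (max (R₂₁ - min (μ₀ * n₁) (μ₀ * n₂) - lo₂₁) (R₂₂ - min (μ₀ * n₁) (μ₀ * n₂) - lo₂₂) +
              (U₂ - U₁) *
                (max (A₂₁ - min ((lo₁₂ - lo₁₁) / (U₂ - U₁)) ((lo₂₂ - lo₂₁) / (U₂ - U₁))) 0 *
                  max (max ((lo₁₂ - lo₁₁) / (U₂ - U₁)) ((lo₂₂ - lo₂₁) / (U₂ - U₁)) - B₂₂) 0) /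
                (max (A₂₁ - min ((lo₁₂ - lo₁₁) / (U₂ - U₁)) ((lo₂₂ - lo₂₁) / (U₂ - U₁))) 0 +
                  max (max ((lo₁₂ - lo₁₁) / (U₂ - U₁)) ((lo₂₂ - lo₂₁) / (U₂ - U₁)) - B₂₂) 0)) +
          (s₂ - s₁) *
            (max (max (K₁₁ - (lo₂₁ - lo₁₁) / (s₂ - s₁)) (K₁₂ - (lo₂₂ - lo₁₂) / (s₂ - s₁))) 0 *
              max (max ((lo₂₁ - lo₁₁) / (s₂ - s₁) - J₂₁) ((lo₂₂ - lo₁₂) / (s₂ - s₁) - J₂₂)) 0) /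
            (max (max (K₁₁ - (lo₂₁ - lo₁₁) / (s₂ - s₁)) (K₁₂ - (lo₂₂ - lo₁₂) / (s₂ - s₁))) 0 +
              max (max ((lo₂₁ - lo₁₁) / (s₂ - s₁) - J₂₁) ((lo₂₂ - lo₁₂) / (s₂ - s₁) - J₂₂)) 0) +
          32 / Real.pi ^ 2 * ((max |eSS.encl.fst| |eSS.encl.snd| : ℚ) : ℝ) + ε) / h) B := by
  intro p hp ε σ hσ hρ hε
  have hSm := mem_ratCast_iff.1 (hp _ _ hS)
  have hUm := mem_ratCast_iff.1 (hp _ _ hU)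
  have hNm := mem_ratCast_iff.1 (hp _ _ hN)
  have hs₁' : s₁ ≤ p .tpOverT := hS₁.trans hSm.1
  have hs₂' : p .tpOverT ≤ s₂ := hSm.2.trans hS₂
  have hU₁' : U₁ ≤ p .UOverT := hU₁.trans hUm.1
  have hU₂' : p .UOverT ≤ U₂ := hUm.2.trans hU₂
  have hn : p .filling ∈ Set.Icc n₁ n₂ := ⟨hn₁.trans hNm.1, hNm.2.trans hn₂⟩
  have hn0 : 0 < p .filling := hn₁0.trans_le hn.1
  have hn2 : p .filling < 2 := lt_of_le_of_lt hn.2 hn₂2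
  have hk := meanEnergy_pairSource_le_nestedBulge_of_rect_filling hU₁0 hs hUlt hn0 hn2 hh μ₀ (hR₁₁ _ hn)
    (hR₂₁ _ hn) (hR₁₂ _ hn) (hR₂₂ _ hn) (h₁₁ _ hn) (h₁₂ _ hn) (h₂₁ _ hn) (h₂₂ _ hn) hlo₁₁ hlo₂₁ hlo₁₂ hlo₂₂
    hs₁' hs₂' hU₁' hU₂' (p .tppOverT) hσ hρ hε
  have h4 : |p .tppOverT| ≤ ((max |eSS.encl.fst| |eSS.encl.snd| : ℚ) : ℝ) := Entry.abs_le_of_mem (hp _ _ hSS)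
  have hc := min_mul_le_mul_of_mem_Icc μ₀ hn
  have hmono := nestedBulge_gap_mono (R₁₁ := R₁₁) (R₁₂ := R₁₂) (R₂₁ := R₂₁) (R₂₂ := R₂₂) (lo₁₁ := lo₁₁)
    (lo₁₂ := lo₁₂) (lo₂₁ := lo₂₁) (lo₂₂ := lo₂₂)
    (X₁ := (U₂ - U₁) *
        (max (A₁₁ - min ((lo₁₂ - lo₁₁) / (U₂ - U₁)) ((lo₂₂ - lo₂₁) / (U₂ - U₁))) 0 *
          max (max ((lo₁₂ - lo₁₁) / (U₂ - U₁)) ((lo₂₂ - lo₂₁) / (U₂ - U₁)) - B₁₂) 0) /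
        (max (A₁₁ - min ((lo₁₂ - lo₁₁) / (U₂ - U₁)) ((lo₂₂ - lo₂₁) / (U₂ - U₁))) 0 +
          max (max ((lo₁₂ - lo₁₁) / (U₂ - U₁)) ((lo₂₂ - lo₂₁) / (U₂ - U₁)) - B₁₂) 0))
    (X₂ := (U₂ - U₁) *
        (max (A₂₁ - min ((lo₁₂ - lo₁₁) / (U₂ - U₁)) ((lo₂₂ - lo₂₁) / (U₂ - U₁))) 0 *
          max (max ((lo₁₂ - lo₁₁) / (U₂ - U₁)) ((lo₂₂ - lo₂₁) / (U₂ - U₁)) - B₂₂) 0) /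
        (max (A₂₁ - min ((lo₁₂ - lo₁₁) / (U₂ - U₁)) ((lo₂₂ - lo₂₁) / (U₂ - U₁))) 0 +
          max (max ((lo₁₂ - lo₁₁) / (U₂ - U₁)) ((lo₂₂ - lo₂₁) / (U₂ - U₁)) - B₂₂) 0))
    hc
  have hπ : 0 ≤ 32 / Real.pi ^ 2 := by positivity
  refine hk.trans (div_le_div_of_nonneg_right ?_ hh.le)
  linarith [mul_le_mul_of_nonneg_left h4 hπ, hmono]

/-- **THE ABSENT(`< m₀`) WORD ON THE BOX FROM THE FOUR CORNERS (n-form).** Same data as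
`holdsOn_pairAmplitude_le_nestedBulge_of_cornerWords_filling` and a threshold `m₀` with
`BULGE(min (μ₀·n₁) (μ₀·n₂)) + (32/π²)·m < h·m₀`. Then on `B`: NO translation-invariant canonical minimiser of object M
(`σ.density = p n`, mean energy `= e^M_{p n}` at the member's couplings) has `d`-wave pair amplitude `≥ m₀` — the
object-M «absent beyond `m₀`» word of a material box read off four corner certificates of one rectangle, with the
`t''` model-form residual and the filling strip in the budget and NO coupling-transport cost. [cite: KomaTasaki1994, §1] -/
theorem holdsOn_pairAmplitude_lt_of_cornerWords_filling_near {B : OneBandBox} {eU eS eSS eN : Entry}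
    (hU : B .UOverT = some eU) (hS : B .tpOverT = some eS) (hSS : B .tppOverT = some eSS)
    (hN : B .filling = some eN) {s₁ s₂ U₁ U₂ n₁ n₂ : ℝ}
    (hS₁ : s₁ ≤ ((eS.encl.fst : ℚ) : ℝ)) (hS₂ : ((eS.encl.snd : ℚ) : ℝ) ≤ s₂)
    (hU₁ : U₁ ≤ ((eU.encl.fst : ℚ) : ℝ)) (hU₂ : ((eU.encl.snd : ℚ) : ℝ) ≤ U₂)
    (hn₁ : n₁ ≤ ((eN.encl.fst : ℚ) : ℝ)) (hn₂ : ((eN.encl.snd : ℚ) : ℝ) ≤ n₂)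
    (hU₁0 : 0 ≤ U₁) (hs : s₁ < s₂) (hUlt : U₁ < U₂) (hn₁0 : 0 < n₁) (hn₂2 : n₂ < 2)
    {h : ℝ} (hh : 0 < h) (μ₀ : ℝ)
    {R₁₁ R₂₁ R₁₂ R₂₂ lo₁₁ lo₂₁ lo₁₂ lo₂₂ K₁₁ K₁₂ J₂₁ J₂₂ A₁₁ A₂₁ B₁₂ B₂₂ m₀ : ℝ}
    (hR₁₁ : ∀ n ∈ Set.Icc n₁ n₂, energyDensityTT' 1 s₁ U₁ n ≤ R₁₁)
    (hR₂₁ : ∀ n ∈ Set.Icc n₁ n₂, energyDensityTT' 1 s₂ U₁ n ≤ R₂₁)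
    (hR₁₂ : ∀ n ∈ Set.Icc n₁ n₂, energyDensityTT' 1 s₁ U₂ n ≤ R₁₂)
    (hR₂₂ : ∀ n ∈ Set.Icc n₁ n₂, energyDensityTT' 1 s₂ U₂ n ≤ R₂₂)
    (h₁₁ : ∀ n ∈ Set.Icc n₁ n₂, ∀ (ω : InfVolFermionState 2) (Ls : ℕ → ℕ)
      (ψ : ∀ L, Fock (Orb (FermionTorus 2 L))),
      Tendsto Ls atTop atTop →
      (∀ j, IsGroundStateInSector (hubbardTorusTT' (Ls j) 1 s₁ U₁) (rectN n (Ls j)) 0 (ψ (Ls j))) →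
      (∀ j, star (ψ (Ls j)) ⬝ᵥ ψ (Ls j) = 1) → ω.IsTorusLimitOf ψ Ls →
      ω.meanEnergy (hubbardTTPrimeFermionInteraction 0 1 0) 1 ≤ K₁₁ ∧
        (ω.expect ({0} : Finset (Site 2))
          (nAt 0 (Finset.mem_singleton_self 0) 0 * nAt 0 (Finset.mem_singleton_self 0) 1)).re ≤ A₁₁)
    (h₁₂ : ∀ n ∈ Set.Icc n₁ n₂, ∀ (ω : InfVolFermionState 2) (Ls : ℕ → ℕ)
      (ψ : ∀ L, Fock (Orb (FermionTorus 2 L))),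
      Tendsto Ls atTop atTop →
      (∀ j, IsGroundStateInSector (hubbardTorusTT' (Ls j) 1 s₁ U₂) (rectN n (Ls j)) 0 (ψ (Ls j))) →
      (∀ j, star (ψ (Ls j)) ⬝ᵥ ψ (Ls j) = 1) → ω.IsTorusLimitOf ψ Ls →
      ω.meanEnergy (hubbardTTPrimeFermionInteraction 0 1 0) 1 ≤ K₁₂ ∧
        B₁₂ ≤ (ω.expect ({0} : Finset (Site 2))
          (nAt 0 (Finset.mem_singleton_self 0) 0 * nAt 0 (Finset.mem_singleton_self 0) 1)).re)
    (h₂₁ : ∀ n ∈ Set.Icc n₁ n₂, ∀ (ω : InfVolFermionState 2) (Ls : ℕ → ℕ)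
      (ψ : ∀ L, Fock (Orb (FermionTorus 2 L))),
      Tendsto Ls atTop atTop →
      (∀ j, IsGroundStateInSector (hubbardTorusTT' (Ls j) 1 s₂ U₁) (rectN n (Ls j)) 0 (ψ (Ls j))) →
      (∀ j, star (ψ (Ls j)) ⬝ᵥ ψ (Ls j) = 1) → ω.IsTorusLimitOf ψ Ls →
      J₂₁ ≤ ω.meanEnergy (hubbardTTPrimeFermionInteraction 0 1 0) 1 ∧
        (ω.expect ({0} : Finset (Site 2))
          (nAt 0 (Finset.mem_singleton_self 0) 0 * nAt 0 (Finset.mem_singleton_self 0) 1)).re ≤ A₂₁)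
    (h₂₂ : ∀ n ∈ Set.Icc n₁ n₂, ∀ (ω : InfVolFermionState 2) (Ls : ℕ → ℕ)
      (ψ : ∀ L, Fock (Orb (FermionTorus 2 L))),
      Tendsto Ls atTop atTop →
      (∀ j, IsGroundStateInSector (hubbardTorusTT' (Ls j) 1 s₂ U₂) (rectN n (Ls j)) 0 (ψ (Ls j))) →
      (∀ j, star (ψ (Ls j)) ⬝ᵥ ψ (Ls j) = 1) → ω.IsTorusLimitOf ψ Ls →
      J₂₂ ≤ ω.meanEnergy (hubbardTTPrimeFermionInteraction 0 1 0) 1 ∧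
        B₂₂ ≤ (ω.expect ({0} : Finset (Site 2))
          (nAt 0 (Finset.mem_singleton_self 0) 0 * nAt 0 (Finset.mem_singleton_self 0) 1)).re)
    (hlo₁₁ : lo₁₁ ≤ dWaveSourceEnergyDensityTT' s₁ U₁ μ₀ h) (hlo₂₁ : lo₂₁ ≤ dWaveSourceEnergyDensityTT' s₂ U₁ μ₀ h)
    (hlo₁₂ : lo₁₂ ≤ dWaveSourceEnergyDensityTT' s₁ U₂ μ₀ h) (hlo₂₂ : lo₂₂ ≤ dWaveSourceEnergyDensityTT' s₂ U₂ μ₀ h)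
    (hnear :
      max (max (R₁₁ - min (μ₀ * n₁) (μ₀ * n₂) - lo₁₁) (R₁₂ - min (μ₀ * n₁) (μ₀ * n₂) - lo₁₂) +
              (U₂ - U₁) *
                (max (A₁₁ - min ((lo₁₂ - lo₁₁) / (U₂ - U₁)) ((lo₂₂ - lo₂₁) / (U₂ - U₁))) 0 *
                  max (max ((lo₁₂ - lo₁₁) / (U₂ - U₁)) ((lo₂₂ - lo₂₁) / (U₂ - U₁)) - B₁₂) 0) /
                (max (A₁₁ - min ((lo₁₂ - lo₁₁) / (U₂ - U₁)) ((lo₂₂ - lo₂₁) / (U₂ - U₁))) 0 +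
                  max (max ((lo₁₂ - lo₁₁) / (U₂ - U₁)) ((lo₂₂ - lo₂₁) / (U₂ - U₁)) - B₁₂) 0))
            (max (R₂₁ - min (μ₀ * n₁) (μ₀ * n₂) - lo₂₁) (R₂₂ - min (μ₀ * n₁) (μ₀ * n₂) - lo₂₂) +
              (U₂ - U₁) *
                (max (A₂₁ - min ((lo₁₂ - lo₁₁) / (U₂ - U₁)) ((lo₂₂ - lo₂₁) / (U₂ - U₁))) 0 *
                  max (max ((lo₁₂ - lo₁₁) / (U₂ - U₁)) ((lo₂₂ - lo₂₁) / (U₂ - U₁)) - B₂₂) 0) /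
                (max (A₂₁ - min ((lo₁₂ - lo₁₁) / (U₂ - U₁)) ((lo₂₂ - lo₂₁) / (U₂ - U₁))) 0 +
                  max (max ((lo₁₂ - lo₁₁) / (U₂ - U₁)) ((lo₂₂ - lo₂₁) / (U₂ - U₁)) - B₂₂) 0)) +
          (s₂ - s₁) *
            (max (max (K₁₁ - (lo₂₁ - lo₁₁) / (s₂ - s₁)) (K₁₂ - (lo₂₂ - lo₁₂) / (s₂ - s₁))) 0 *
              max (max ((lo₂₁ - lo₁₁) / (s₂ - s₁) - J₂₁) ((lo₂₂ - lo₁₂) / (s₂ - s₁) - J₂₂)) 0) /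
            (max (max (K₁₁ - (lo₂₁ - lo₁₁) / (s₂ - s₁)) (K₁₂ - (lo₂₂ - lo₁₂) / (s₂ - s₁))) 0 +
              max (max ((lo₂₁ - lo₁₁) / (s₂ - s₁) - J₂₁) ((lo₂₂ - lo₁₂) / (s₂ - s₁) - J₂₂)) 0) +
          32 / Real.pi ^ 2 * ((max |eSS.encl.fst| |eSS.encl.snd| : ℚ) : ℝ) < h * m₀) :
    HoldsOn (fun p : OneBandCoord → ℝ => ∀ σ : InfVolFermionState 2, σ.IsTranslationInvariant →
      σ.density = p .filling →
      σ.meanEnergy (hubbardTT'T''FermionInteraction 1 (p .tpOverT) (p .tppOverT) (p .UOverT)) 2 ≤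
        (hubbardTT'T''FermionInteraction 1 (p .tpOverT) (p .tppOverT) (p .UOverT)).tiGroundEnergyDensityAt 2
          (p .filling) →
      σ.meanEnergy (pairSourceInteraction dWaveFormFactor) 1 < m₀) B := by
  intro p hp σ hσ hρ hmin
  have hk := holdsOn_pairAmplitude_le_nestedBulge_of_cornerWords_filling hU hS hSS hN hS₁ hS₂ hU₁ hU₂ hn₁ hn₂
    hU₁0 hs hUlt hn₁0 hn₂2 hh μ₀ hR₁₁ hR₂₁ hR₁₂ hR₂₂ h₁₁ h₁₂ h₂₁ h₂₂ hlo₁₁ hlo₂₁ hlo₁₂ hlo₂₂ p hp 0 σ hσ hρ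
    (by rw [add_zero]; exact hmin)
  rw [add_zero] at hk
  refine hk.trans_lt ?_
  rw [div_lt_iff₀ hh]
  linarith [hnear]

/-! ### §2 The La-214 `x = 1/8` object-E box of record v1.9: the target shape for S2 -/

/-- The `tpp/t_eff` magnitude of `boxLa214E_M15v19` is `0` (object E carries no third-neighbour term). [folklore] -/
theorem la214E_M15v19_tpp_abs : (max |la214E_M15v19_tpp.encl.fst| |la214E_M15v19_tpp.encl.snd| : ℚ) = 0 := by
  rw [la214E_M15v19_tpp, Entry.encl_ofEnds_fst, Entry.encl_ofEnds_snd]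
  norm_num

/-- **THE TARGET SHAPE FOR S2 ON THE La-214 `x = 1/8` OBJECT-E BOX OF RECORD v1.9** (`boxLa214E_M15v19`, p492071:
`U/t_eff ∈ [6.1, 14.7]`, `tp/t_eff ∈ [−0.30, −0.20]`, `n ∈ [0.855, 0.895]`, `tpp/t_eff = 0`). Rectangle = the box's
own cell corners `(s₁, s₂) = (−3/10, −1/5)`, `(U₁, U₂) = (61/10, 147/10)`, strip `[171/200, 179/200]`: four canonical
corner caps and four corner slope-word pairs for every `n` in the strip, four sourced corner floors at `μ₀`, and ONE
inequality `BULGE(min (μ₀·0.855) (μ₀·0.895)) < h·m₀` (no `t''` term: object E) give ABSENT(`< m₀`) for the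
translation-invariant canonical minimisers of the box's `t–t'` model at every member's couplings and filling.
Sixteen corner inputs, zero transport cost. [cite: KomaTasaki1994, §1] -/
theorem boxLa214E_M15v19_pairAmplitude_lt_of_cornerWords {h : ℝ} (hh : 0 < h) (μ₀ : ℝ)
    {R₁₁ R₂₁ R₁₂ R₂₂ lo₁₁ lo₂₁ lo₁₂ lo₂₂ K₁₁ K₁₂ J₂₁ J₂₂ A₁₁ A₂₁ B₁₂ B₂₂ m₀ : ℝ}
    (hR₁₁ : ∀ n ∈ Set.Icc (171/200 : ℝ) (179/200), energyDensityTT' 1 (-3/10) (61/10) n ≤ R₁₁)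
    (hR₂₁ : ∀ n ∈ Set.Icc (171/200 : ℝ) (179/200), energyDensityTT' 1 (-1/5) (61/10) n ≤ R₂₁)
    (hR₁₂ : ∀ n ∈ Set.Icc (171/200 : ℝ) (179/200), energyDensityTT' 1 (-3/10) (147/10) n ≤ R₁₂)
    (hR₂₂ : ∀ n ∈ Set.Icc (171/200 : ℝ) (179/200), energyDensityTT' 1 (-1/5) (147/10) n ≤ R₂₂)
    (h₁₁ : ∀ n ∈ Set.Icc (171/200 : ℝ) (179/200), ∀ (ω : InfVolFermionState 2) (Ls : ℕ → ℕ)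
      (ψ : ∀ L, Fock (Orb (FermionTorus 2 L))),
      Tendsto Ls atTop atTop →
      (∀ j, IsGroundStateInSector (hubbardTorusTT' (Ls j) 1 (-3/10) (61/10)) (rectN n (Ls j)) 0 (ψ (Ls j))) →
      (∀ j, star (ψ (Ls j)) ⬝ᵥ ψ (Ls j) = 1) → ω.IsTorusLimitOf ψ Ls →
      ω.meanEnergy (hubbardTTPrimeFermionInteraction 0 1 0) 1 ≤ K₁₁ ∧
        (ω.expect ({0} : Finset (Site 2))
          (nAt 0 (Finset.mem_singleton_self 0) 0 * nAt 0 (Finset.mem_singleton_self 0) 1)).re ≤ A₁₁)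
    (h₁₂ : ∀ n ∈ Set.Icc (171/200 : ℝ) (179/200), ∀ (ω : InfVolFermionState 2) (Ls : ℕ → ℕ)
      (ψ : ∀ L, Fock (Orb (FermionTorus 2 L))),
      Tendsto Ls atTop atTop →
      (∀ j, IsGroundStateInSector (hubbardTorusTT' (Ls j) 1 (-3/10) (147/10)) (rectN n (Ls j)) 0 (ψ (Ls j))) →
      (∀ j, star (ψ (Ls j)) ⬝ᵥ ψ (Ls j) = 1) → ω.IsTorusLimitOf ψ Ls →
      ω.meanEnergy (hubbardTTPrimeFermionInteraction 0 1 0) 1 ≤ K₁₂ ∧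
        B₁₂ ≤ (ω.expect ({0} : Finset (Site 2))
          (nAt 0 (Finset.mem_singleton_self 0) 0 * nAt 0 (Finset.mem_singleton_self 0) 1)).re)
    (h₂₁ : ∀ n ∈ Set.Icc (171/200 : ℝ) (179/200), ∀ (ω : InfVolFermionState 2) (Ls : ℕ → ℕ)
      (ψ : ∀ L, Fock (Orb (FermionTorus 2 L))),
      Tendsto Ls atTop atTop →
      (∀ j, IsGroundStateInSector (hubbardTorusTT' (Ls j) 1 (-1/5) (61/10)) (rectN n (Ls j)) 0 (ψ (Ls j))) →
      (∀ j, star (ψ (Ls j)) ⬝ᵥ ψ (Ls j) = 1) → ω.IsTorusLimitOf ψ Ls →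
      J₂₁ ≤ ω.meanEnergy (hubbardTTPrimeFermionInteraction 0 1 0) 1 ∧
        (ω.expect ({0} : Finset (Site 2))
          (nAt 0 (Finset.mem_singleton_self 0) 0 * nAt 0 (Finset.mem_singleton_self 0) 1)).re ≤ A₂₁)
    (h₂₂ : ∀ n ∈ Set.Icc (171/200 : ℝ) (179/200), ∀ (ω : InfVolFermionState 2) (Ls : ℕ → ℕ)
      (ψ : ∀ L, Fock (Orb (FermionTorus 2 L))),
      Tendsto Ls atTop atTop →
      (∀ j, IsGroundStateInSector (hubbardTorusTT' (Ls j) 1 (-1/5) (147/10)) (rectN n (Ls j)) 0 (ψ (Ls j))) →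
      (∀ j, star (ψ (Ls j)) ⬝ᵥ ψ (Ls j) = 1) → ω.IsTorusLimitOf ψ Ls →
      J₂₂ ≤ ω.meanEnergy (hubbardTTPrimeFermionInteraction 0 1 0) 1 ∧
        B₂₂ ≤ (ω.expect ({0} : Finset (Site 2))
          (nAt 0 (Finset.mem_singleton_self 0) 0 * nAt 0 (Finset.mem_singleton_self 0) 1)).re)
    (hlo₁₁ : lo₁₁ ≤ dWaveSourceEnergyDensityTT' (-3/10) (61/10) μ₀ h)
    (hlo₂₁ : lo₂₁ ≤ dWaveSourceEnergyDensityTT' (-1/5) (61/10) μ₀ h)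
    (hlo₁₂ : lo₁₂ ≤ dWaveSourceEnergyDensityTT' (-3/10) (147/10) μ₀ h)
    (hlo₂₂ : lo₂₂ ≤ dWaveSourceEnergyDensityTT' (-1/5) (147/10) μ₀ h)
    (hnear :
      max (max (R₁₁ - min (μ₀ * (171/200)) (μ₀ * (179/200)) - lo₁₁)
              (R₁₂ - min (μ₀ * (171/200)) (μ₀ * (179/200)) - lo₁₂) +
              ((147/10 : ℝ) - 61/10) *
                (max (A₁₁ - min ((lo₁₂ - lo₁₁) / ((147/10 : ℝ) - 61/10)) ((lo₂₂ - lo₂₁) / ((147/10 : ℝ) - 61/10))) 0 *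
                  max (max ((lo₁₂ - lo₁₁) / ((147/10 : ℝ) - 61/10)) ((lo₂₂ - lo₂₁) / ((147/10 : ℝ) - 61/10)) - B₁₂) 0) /
                (max (A₁₁ - min ((lo₁₂ - lo₁₁) / ((147/10 : ℝ) - 61/10)) ((lo₂₂ - lo₂₁) / ((147/10 : ℝ) - 61/10))) 0 +
                  max (max ((lo₁₂ - lo₁₁) / ((147/10 : ℝ) - 61/10)) ((lo₂₂ - lo₂₁) / ((147/10 : ℝ) - 61/10)) - B₁₂) 0))
            (max (R₂₁ - min (μ₀ * (171/200)) (μ₀ * (179/200)) - lo₂₁)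
              (R₂₂ - min (μ₀ * (171/200)) (μ₀ * (179/200)) - lo₂₂) +
              ((147/10 : ℝ) - 61/10) *
                (max (A₂₁ - min ((lo₁₂ - lo₁₁) / ((147/10 : ℝ) - 61/10)) ((lo₂₂ - lo₂₁) / ((147/10 : ℝ) - 61/10))) 0 *
                  max (max ((lo₁₂ - lo₁₁) / ((147/10 : ℝ) - 61/10)) ((lo₂₂ - lo₂₁) / ((147/10 : ℝ) - 61/10)) - B₂₂) 0) /
                (max (A₂₁ - min ((lo₁₂ - lo₁₁) / ((147/10 : ℝ) - 61/10)) ((lo₂₂ - lo₂₁) / ((147/10 : ℝ) - 61/10))) 0 +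
                  max (max ((lo₁₂ - lo₁₁) / ((147/10 : ℝ) - 61/10)) ((lo₂₂ - lo₂₁) / ((147/10 : ℝ) - 61/10)) - B₂₂) 0)) +
          ((-1/5 : ℝ) - (-3/10)) *
            (max (max (K₁₁ - (lo₂₁ - lo₁₁) / ((-1/5 : ℝ) - (-3/10))) (K₁₂ - (lo₂₂ - lo₁₂) / ((-1/5 : ℝ) - (-3/10)))) 0 *
              max (max ((lo₂₁ - lo₁₁) / ((-1/5 : ℝ) - (-3/10)) - J₂₁) ((lo₂₂ - lo₁₂) / ((-1/5 : ℝ) - (-3/10)) - J₂₂)) 0) /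
            (max (max (K₁₁ - (lo₂₁ - lo₁₁) / ((-1/5 : ℝ) - (-3/10))) (K₁₂ - (lo₂₂ - lo₁₂) / ((-1/5 : ℝ) - (-3/10)))) 0 +
              max (max ((lo₂₁ - lo₁₁) / ((-1/5 : ℝ) - (-3/10)) - J₂₁) ((lo₂₂ - lo₁₂) / ((-1/5 : ℝ) - (-3/10)) - J₂₂)) 0)
        < h * m₀) :
    HoldsOn (fun p : OneBandCoord → ℝ => ∀ σ : InfVolFermionState 2, σ.IsTranslationInvariant →
      σ.density = p .filling →
      σ.meanEnergy (hubbardTT'T''FermionInteraction 1 (p .tpOverT) (p .tppOverT) (p .UOverT)) 2 ≤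
        (hubbardTT'T''FermionInteraction 1 (p .tpOverT) (p .tppOverT) (p .UOverT)).tiGroundEnergyDensityAt 2
          (p .filling) →
      σ.meanEnergy (pairSourceInteraction dWaveFormFactor) 1 < m₀) boxLa214E_M15v19 := by
  refine holdsOn_pairAmplitude_lt_of_cornerWords_filling_near (B := boxLa214E_M15v19) (eU := la214E_M15v19_U)
    (eS := la214E_M15v19_tp) (eSS := la214E_M15v19_tpp) (eN := la214E_M15v19_n) rfl rfl rfl rfl
    (s₁ := -3/10) (s₂ := -1/5) (U₁ := 61/10) (U₂ := 147/10) (n₁ := 171/200) (n₂ := 179/200)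
    (by rw [la214E_M15v19_tp, Entry.encl_ofEnds_fst]; norm_num)
    (by rw [la214E_M15v19_tp, Entry.encl_ofEnds_snd]; norm_num)
    (by rw [la214E_M15v19_U, Entry.encl_ofEnds_fst]; norm_num)
    (by rw [la214E_M15v19_U, Entry.encl_ofEnds_snd]; norm_num)
    (by rw [la214E_M15v19_n, Entry.encl_ofEnds_fst]; norm_num)
    (by rw [la214E_M15v19_n, Entry.encl_ofEnds_snd]; norm_num)
    (by norm_num) (by norm_num) (by norm_num) (by norm_num) (by norm_num) hh μ₀ hR₁₁ hR₂₁ hR₁₂ hR₂₂ h₁₁ h₁₂ h₂₁ h₂₂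
    hlo₁₁ hlo₂₁ hlo₁₂ hlo₂₂ ?_
  rw [la214E_M15v19_tpp_abs]
  push_cast
  rw [mul_zero, add_zero]
  exact hnear

end Summit.Ventures.CertifiedManyBodySolver.Downfold

end
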